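import Literature.NumberTheory.LFunctions.Zhang2022.DetectorDoublingCompose
import Literature.NumberTheory.LFunctions.Zhang2022.DetectorTwoSidedArcs
import Literature.NumberTheory.LFunctions.Zhang2022.DetectorGlueForm

/-!
# [K6″] The TWO-SIDED doubling route composed: `Det.FormDetGlued b ⪰ 0` on the no-overlap two-sided class
# for every sign-admissible triple, given the two-point piece [K2″] (displayed), via ONE function on the circle

Y. Zhang, *Discrete mean estimates and the Landau–Siegel zero*, arXiv:2211.02515v1 [Zhang2022LandauSiegel] —
an unrefereed manuscript under adjudication. **WHAT THIS IS NOT: not a claim about Theorems 1–2 of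
arXiv:2211.02515, about Landau–Siegel zeros, about a repaired `Margin232`, or about Parity; nothing here asserts
E-102, the E-010 slot, or the (A)-world meaning of the glued form (registry row «formula II at general b»).
The programme SEARCHES and TYPES; no claim about Landau–Siegel zeros, Theorems 1–2 of arXiv:2211.02515 or a
repaired Margin232 until a kernel theorem says so.**

CONTEXT (cell landau-siegel §E; ls-barrier-num g3 `barrier/num/TWO-SIDED-CIRCLE.md` 848781c68d919926 §5 «Lean
plan», items K1″/K6″; ls-num-2 g4 Id-5 (two-lineage exact identity, ledger l.7397); the one-sided twin is [K6]
`DetectorDoublingCompose`, ls-Bdet-typer-2 g2). The object is the tree's glued two-sided form WITHOUT window term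
(`DetectorGlueForm`, exact for non-overlapping supports):
`FormDetGlued b g₁ g₁' g₂ g₂' = 𝔅_{R(b)}(g₁) + 𝔅_{R(b)}(g₂) + 2Re F₀`,
`F₀ = F0DetC (shiftGlueW b) (shiftGlue0 b) b (g₁ 0) (∫g₁) (g₂ 0) (∫g₂)`.

* Part 1 [K1″] (bookkeeping over [K1] `Det.formDet_shiftRecipe_eq_bulk_add_freeEnd`, ls-barrier-p2 g3):
  `(π/2)·FormDetGlued = c₀·[T_b^{[0,1]}(S₁) + T_b^{[0,1]}(S₂)] + F_b(x₁) + F_b(x₂) + π·Re F₀`, `S_i = tailPrim g_i`,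
  `x_i = (∫g_i, −g_i(0))`, `c₀ = Re Σ_j W_j`, `T_b = Det.bulkFormOn b`, `F_b = Det.freeEndForm b`.
* Part 2 [K6″, interface form] `formDetGlued_nonneg_of_twoPointPiece`: for a sign-admissible `b`, one-sided kinked
  `g₁` supported in `[0,t₁]`, `g₂` supported in `[0,t₂]` (two-sided differentiable off a finite node set),
  `t₁ + t₂ ≤ 1`, and ANY two-point piece `E` on `[0,1]` (continuous with right-derivatives `E′, E″`, jets
  `(E,E′)(0) = (−conj ∫g₂, −conj g₂(0))`, `(E,E′)(1) = (∫g₁, −g₁(0))`) with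
  `c₀·T_b^{[0,1]}(E) = F_b(x₁) + F_b(x₂) + π·Re F₀` — the [K2″] two-point identity of TWO-SIDED-CIRCLE §1
  (R)+(L)+(X), DISPLAYED here as a hypothesis exactly as [K6] displays [K2] — `0 ≤ FormDetGlued b g₁ g₁' g₂ g₂'`.
  Proof: the circle function `E(·+1)` on `[−1,0]`, `S₁ − conj S₂(1−·)` on `[0,1]` is periodic `C¹` on the cell
  `[−1,1]` with finitely many nodes (`DetectorTwoSidedArcs`), so its bulk form is `≥ 0` ([K3′]); by Part 1, the
  reflection invariance / separated additivity of `T_b` and [K6]'s `bulkFormOn_comp_add_one` it equals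
  `(π/2)·FormDetGlued / c₀`, and `c₀ > 0` ([K5] `Det.re_sum_shiftW_pos`).
* `formDetGlued_nonneg_of_twoPointPieces`: the same with [K2″] quantified over all jet data (the interface the
  leaf `DetectorTwoPointIdentity` (ls-barrier-num g3, in typing) discharges verbatim).

0 named facts, 0 `def`s, 0 sorries; standard axioms. Cell landau-siegel, ls-barrier-p5 g4 (CLAIM
2026-08-27T03:08:50Z). References: Y. Zhang, arXiv:2211.02515v1 (2022), Prop. 7.1 p.44 with (7.2), §8 (8.2),
(8.11)–(8.23), §12 (12.6)–(12.8), Prop. 14.1, Lemma 15.1, §18 (18.1); barrier/num/TWO-SIDED-CIRCLE.md,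
H-CLOSED-FORM.md §§10–11 (ls-barrier-num, cell-internal).
[cite: Zhang2022LandauSiegel, Prop 7.1 p.44 with (7.2), (8.11)–(8.23)]
-/

noncomputable section

open Complex Real Set intervalIntegral Filter Topology
open _root_.MeasureTheory
open scoped ComplexConjugate

namespace Literature.NumberTheory.LFunctions.Zhang2022

namespace Det

open Repair

variable {b : Fin 3 → ℝ} {g₁ g₁' g₂ g₂' : ℝ → ℂ}

/-! ### Part 1 — [K1″] the glued form in bulk / free-end / cross coordinates -/

/-- **[K1″]** `(π/2)·FormDetGlued b (g₁,g₂) = c₀·[T_b^{[0,1]}(S₁) + T_b^{[0,1]}(S₂)] + F_b(∫g₁, −g₁0) + F_b(∫g₂, −g₂0)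
+ π·Re F₀(g₁0, ∫g₁; g₂0, ∫g₂)` for one-sided kinked `g₁, g₂` and a distinct triple `b` ([K1] on each side).
[cite: Zhang2022LandauSiegel, Prop 7.1 p.44 with (7.2), (8.11)–(8.23); §18 (18.1)] -/
theorem formDetGlued_eq_bulk_add (hb : Function.Injective b) (hg₁ : KinkedProfile g₁ g₁') (h1₁ : g₁ 1 = 0)
    (hg₂ : KinkedProfile g₂ g₂') (h1₂ : g₂ 1 = 0) :
    π / 2 * FormDetGlued b g₁ g₁' g₂ g₂'
      = (∑ j : Fin 3, shiftW b j).re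
          * (bulkFormOn b 0 1 (tailPrim g₁) (fun y => -g₁ y) (fun y => -g₁' y)
            + bulkFormOn b 0 1 (tailPrim g₂) (fun y => -g₂ y) (fun y => -g₂' y))
        + (freeEndForm b (∫ y in (0:ℝ)..1, g₁ y) (-g₁ 0) + freeEndForm b (∫ y in (0:ℝ)..1, g₂ y) (-g₂ 0)
          + π * (F0DetC (shiftGlueW b) (shiftGlue0 b) b (g₁ 0) (∫ y in (0:ℝ)..1, g₁ y) (g₂ 0)
              (∫ y in (0:ℝ)..1, g₂ y)).re) := by
  have h₁ := formDet_shiftRecipe_eq_bulk_add_freeEnd hb hg₁ h1₁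
  have h₂ := formDet_shiftRecipe_eq_bulk_add_freeEnd hb hg₂ h1₂
  have hbb : (shiftRecipe b).b = b := rfl
  unfold FormDetGlued FormDetTwoSidedC
  rw [hbb]
  linear_combination h₁ + h₂

/-! ### Part 2 — [K6″] the composition: `FormDetGlued b ⪰ 0` on the no-overlap two-sided class, given [K2″] -/

section Compose

variable {g₁ g₁' g₂ g₂' : ℝ → ℂ}

/-- Continuity transported along `y ↦ y + 1` (as in [K6]). [folklore] -/
private theorem continuousOn_translate_one {F : ℝ → ℂ} (hF : ContinuousOn F (Icc 0 1)) :
    ContinuousOn (fun y => F (y + 1)) (Icc (-1) 0) := by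
  refine hF.comp (continuous_id.add continuous_const).continuousOn fun y hy => ?_
  exact ⟨by linarith [hy.1], by linarith [hy.2]⟩

/-- Right-derivatives transported along `y ↦ y + 1` (as in [K6]). [folklore] -/
private theorem hasDerivWithinAt_translate_one {F F' : ℝ → ℂ}
    (hF : ∀ y ∈ Ioo (0:ℝ) 1, HasDerivWithinAt F (F' y) (Ioi y) y) {y : ℝ} (hy : y ∈ Ioo (-1:ℝ) 0) :
    HasDerivWithinAt (fun y => F (y + 1)) (F' (y + 1)) (Ioi y) y := by
  have hy' : y + 1 ∈ Ioo (0:ℝ) 1 := ⟨by linarith [hy.1], by linarith [hy.2]⟩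
  have h := hF (y + 1) hy'
  have h2 : HasDerivWithinAt (fun t : ℝ => t + 1) (1:ℝ) (Ioi y) y := (hasDerivAt_id y).add_const 1 |>.hasDerivWithinAt
  have := h.scomp y h2 (fun t ht => by simpa using ht)
  rw [Function.comp_def] at this
  simpa using this

/-- **[K6″] interface form (the two-point piece displayed).** Let `b` be sign-admissible; `g₁, g₂` one-sided kinked
profiles on `[0,1]` SUPPORTED in `[0,t₁]`, `[0,t₂]` (profile and derivative companion vanish on `[t_i,1]`) with
NO OVERLAP after reflection, `t₁ + t₂ ≤ 1`; `g₂` (the reflected side) differentiable outside a finite node set `N`.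
If `E` is a piece on `[0,1]` (continuous with right-derivatives `E′, E″`) with the two-point jets
`(E,E′)(0) = (−conj ∫₀¹g₂, −conj g₂(0))`, `(E,E′)(1) = (∫₀¹g₁, −g₁(0))` and the [K2″] identity
`c₀·T_b^{[0,1]}(E) = F_b(∫g₁,−g₁0) + F_b(∫g₂,−g₂0) + π·Re F₀(g₁0,∫g₁; g₂0,∫g₂)`, then `0 ≤ FormDetGlued b g₁ g₁′ g₂ g₂′`.
(The circle function `E(·+1) ⊕ (S₁ − conj S₂(1−·))` on `[−1,1]`; Parts 1–4; [K3′]; [K5].)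
[cite: Zhang2022LandauSiegel, Prop 7.1 p.44 with (7.2), (8.11)–(8.23); §8 (8.2); §12 (12.6)–(12.8); §18 (18.1)] -/
theorem formDetGlued_nonneg_of_twoPointPiece (hb : SignAdmissible b)
    (hg₁ : KinkedProfile g₁ g₁') (hg₂ : KinkedProfile g₂ g₂') {t₁ t₂ : ℝ} (ht₁ : 0 ≤ t₁) (ht₂ : 0 ≤ t₂)
    (ht : t₁ + t₂ ≤ 1)
    (hz₁ : ∀ y ∈ Icc t₁ 1, g₁ y = 0 ∧ g₁' y = 0) (hz₂ : ∀ y ∈ Icc t₂ 1, g₂ y = 0 ∧ g₂' y = 0)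
    (N : Finset ℝ) (hN : ∀ x ∈ Ioo (0:ℝ) 1, x ∉ N → HasDerivAt g₂ (g₂' x) x)
    {E E' E'' : ℝ → ℂ} (hc : ContinuousOn E (Icc 0 1)) (hc' : ContinuousOn E' (Icc 0 1))
    (hc'' : ContinuousOn E'' (Icc 0 1))
    (hd : ∀ y ∈ Ioo (0:ℝ) 1, HasDerivWithinAt E (E' y) (Ioi y) y)
    (hd' : ∀ y ∈ Ioo (0:ℝ) 1, HasDerivWithinAt E' (E'' y) (Ioi y) y)
    (hE0 : E 0 = -conj (∫ y in (0:ℝ)..1, g₂ y)) (hE0' : E' 0 = -conj (g₂ 0))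
    (hE1 : E 1 = ∫ y in (0:ℝ)..1, g₁ y) (hE1' : E' 1 = -g₁ 0)
    (hid : (∑ j : Fin 3, shiftW b j).re * bulkFormOn b 0 1 E E' E''
      = freeEndForm b (∫ y in (0:ℝ)..1, g₁ y) (-g₁ 0) + freeEndForm b (∫ y in (0:ℝ)..1, g₂ y) (-g₂ 0)
        + π * (F0DetC (shiftGlueW b) (shiftGlue0 b) b (g₁ 0) (∫ y in (0:ℝ)..1, g₁ y) (g₂ 0)
            (∫ y in (0:ℝ)..1, g₂ y)).re) :
    0 ≤ FormDetGlued b g₁ g₁' g₂ g₂' := by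
  have ht₁1 : t₁ ≤ 1 := by linarith
  have ht₂1 : t₂ ≤ 1 := by linarith
  have h1₁ : g₁ 1 = 0 := (hz₁ 1 ⟨ht₁1, le_rfl⟩).1
  have h1₂ : g₂ 1 = 0 := (hz₂ 1 ⟨ht₂1, le_rfl⟩).1
  -- side 1 arc `S₁ = tailPrim g₁`
  obtain ⟨hS₁c, hS₁'c, hS₁d, hS₁'d, hS₁''m, -, -⟩ := rightPiece_of_kinked hg₁ h1₁
  -- reflected side 2 arc `G = −conj (tailPrim g₂ (1−·))`
  obtain ⟨hGc, hG'c, hGd, hG'd, hG''m⟩ := reflArc_of_kinked hg₂ h1₂ N hN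
  -- separated supports
  have hzS : ∀ y ∈ Icc (0:ℝ) 1, t₁ ≤ y →
      tailPrim g₁ y = 0 ∧ (fun y => -g₁ y) y = 0 ∧ (fun y => -g₁' y) y = 0 := by
    intro y hy hty
    obtain ⟨e0, e1⟩ := hz₁ y ⟨hty, hy.2⟩
    exact ⟨tailPrim_eq_zero_of_support (fun z hz => (hz₁ z hz).1) hy hty, by simp [e0], by simp [e1]⟩
  have hzG : ∀ y ∈ Icc (0:ℝ) 1, y ≤ t₁ →
      (fun y => -conj (tailPrim g₂ (1 - y))) y = 0 ∧ (fun y => conj (-g₂ (1 - y))) y = 0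
        ∧ (fun y => -conj (-g₂' (1 - y))) y = 0 := by
    intro y hy hty
    have hx : 1 - y ∈ Icc (0:ℝ) 1 := ⟨by linarith [hy.2], by linarith [hy.1]⟩
    have htx : t₂ ≤ 1 - y := by linarith
    obtain ⟨e0, e1⟩ := hz₂ (1 - y) ⟨htx, hx.2⟩
    refine ⟨?_, by simp [e0], by simp [e1]⟩
    simp only [tailPrim_eq_zero_of_support (fun z hz => (hz₂ z hz).1) hx htx, map_zero, neg_zero]
  have hA := bulkFormOn_add_of_separated b t₁ hzS hzG hS₁c hS₁'c hS₁''m hGc hG'c hG''m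
  have hrefl := bulkFormOn_reflect_conj b (tailPrim g₂) (fun y => -g₂ y) (fun y => -g₂' y)
  -- the periodic two-piece inequality on the cell `[−1,1]`
  have hcell := bulkFormOn_periodic_two_piece_nonneg_of_signAdmissible hb (N.image fun x => 1 - x)
    (L := fun y => E (y + 1)) (L' := fun y => E' (y + 1)) (L'' := fun y => E'' (y + 1))
    (R := fun y => tailPrim g₁ y + -conj (tailPrim g₂ (1 - y)))
    (R' := fun y => -g₁ y + conj (-g₂ (1 - y)))
    (R'' := fun y => -g₁' y + -conj (-g₂' (1 - y)))
    (continuousOn_translate_one hc) (continuousOn_translate_one hc')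
    (memLp_two_of_continuousOn_Icc' (continuousOn_translate_one hc''))
    (fun y hy => hasDerivWithinAt_translate_one hd hy) (fun y hy => hasDerivWithinAt_translate_one hd' hy)
    (hS₁c.add hGc) (hS₁'c.add hG'c) (hS₁''m.add hG''m)
    (fun y hy => (hS₁d y hy).add (hGd y hy))
    (fun y hy hyN => (hS₁'d y hy).add (hG'd y hy fun h => hyN
      (Finset.mem_image.2 ⟨1 - y, h, sub_sub_cancel 1 y⟩)))
    (by simp only [zero_add, hE1, sub_zero, tailPrim_one, tailPrim_zero, map_zero, neg_zero, add_zero])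
    (by simp only [zero_add, hE1', sub_zero, h1₂, neg_zero, map_zero, add_zero])
    (by simp only [neg_add_cancel, hE0, sub_self, tailPrim_one, tailPrim_zero, zero_add])
    (by simp only [neg_add_cancel, hE0', sub_self, h1₁, neg_zero, map_neg, zero_add])
  rw [bulkFormOn_comp_add_one, hA, hrefl] at hcell
  -- assemble with [K1″] and [K5]
  have hK1 := formDetGlued_eq_bulk_add hb.injective hg₁ h1₁ hg₂ h1₂
  rw [← hid] at hK1
  have hc0 : 0 < (∑ j : Fin 3, shiftW b j).re := re_sum_shiftW_pos hb
  have key : π / 2 * FormDetGlued b g₁ g₁' g₂ g₂'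
      = (∑ j : Fin 3, shiftW b j).re * (bulkFormOn b 0 1 E E' E''
          + (bulkFormOn b 0 1 (tailPrim g₁) (fun y => -g₁ y) (fun y => -g₁' y)
            + bulkFormOn b 0 1 (tailPrim g₂) (fun y => -g₂ y) (fun y => -g₂' y))) := by
    rw [hK1]; ring
  have hπ : 0 < π / 2 := by positivity
  exact (mul_nonneg_iff_of_pos_left hπ).1 (key ▸ mul_nonneg hc0.le hcell)

/-- **[K6″] with the two-point piece quantified over all jet data** — the interface the algebraic leaf [K2″]
(`DetectorTwoPointIdentity`, ls-barrier-num g3: for every `p₁ q₁ p₂ q₂` an explicit exponential extremal on `[0,1]`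
with jets `(−conj p₂, conj q₂)` at `0`, `(p₁, q₁)` at `1` and `c₀·T_b^{[0,1]}(E) = F_b(p₁,q₁) + F_b(p₂,q₂) +
π·Re F0DetC(W′,c_g,b)(−q₁,p₁,−q₂,p₂)`, TWO-SIDED-CIRCLE §1 (R)+(L)+(X)) discharges verbatim: for a sign-admissible
`b`, every no-overlap pair of supported one-sided kinked profiles has `FormDetGlued b (g₁,g₂) ≥ 0`.
[cite: Zhang2022LandauSiegel, Prop 7.1 p.44 with (7.2), (8.11)–(8.23); §8 (8.2); §18 (18.1)] -/
theorem formDetGlued_nonneg_of_twoPointPieces (hb : SignAdmissible b)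
    (hK2 : ∀ p₁ q₁ p₂ q₂ : ℂ, ∃ E E' E'' : ℝ → ℂ,
      ContinuousOn E (Icc 0 1) ∧ ContinuousOn E' (Icc 0 1) ∧ ContinuousOn E'' (Icc 0 1) ∧
      (∀ y ∈ Ioo (0:ℝ) 1, HasDerivWithinAt E (E' y) (Ioi y) y) ∧
      (∀ y ∈ Ioo (0:ℝ) 1, HasDerivWithinAt E' (E'' y) (Ioi y) y) ∧
      E 0 = -conj p₂ ∧ E' 0 = conj q₂ ∧ E 1 = p₁ ∧ E' 1 = q₁ ∧
      (∑ j : Fin 3, shiftW b j).re * bulkFormOn b 0 1 E E' E''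
        = freeEndForm b p₁ q₁ + freeEndForm b p₂ q₂
          + π * (F0DetC (shiftGlueW b) (shiftGlue0 b) b (-q₁) p₁ (-q₂) p₂).re)
    (hg₁ : KinkedProfile g₁ g₁') (hg₂ : KinkedProfile g₂ g₂') {t₁ t₂ : ℝ} (ht₁ : 0 ≤ t₁) (ht₂ : 0 ≤ t₂)
    (ht : t₁ + t₂ ≤ 1)
    (hz₁ : ∀ y ∈ Icc t₁ 1, g₁ y = 0 ∧ g₁' y = 0) (hz₂ : ∀ y ∈ Icc t₂ 1, g₂ y = 0 ∧ g₂' y = 0)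
    (N : Finset ℝ) (hN : ∀ x ∈ Ioo (0:ℝ) 1, x ∉ N → HasDerivAt g₂ (g₂' x) x) :
    0 ≤ FormDetGlued b g₁ g₁' g₂ g₂' := by
  obtain ⟨E, E', E'', hc, hc', hc'', hd, hd', h0, h0', h1, h1', hid⟩ :=
    hK2 (∫ y in (0:ℝ)..1, g₁ y) (-g₁ 0) (∫ y in (0:ℝ)..1, g₂ y) (-g₂ 0)
  rw [map_neg] at h0'
  rw [neg_neg, neg_neg] at hid
  exact formDetGlued_nonneg_of_twoPointPiece hb hg₁ hg₂ ht₁ ht₂ ht hz₁ hz₂ N hN hc hc' hc'' hd hd' h0 h0' h1 h1' hid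

/-- **[K6″] on the tree's no-overlap class `Det.GluedSides`** (`DetectorDictForm`, ls-Bdet-typer-1): for a
sign-admissible `b`, the two-point pieces [K2″], and glued sides `(u,u′ | v,v′)` whose reflected side `v` is
differentiable outside a finite node set, `0 ≤ FormDetGlued b u u′ v v′`. (The shape ls-barrier-p6 g3's
S-E-p6-3 slot `Det.GluedFormPSD` reads, with the node-set hypothesis displayed.)
[cite: Zhang2022LandauSiegel, Prop 7.1 p.44 with (7.2), (8.11)–(8.23); §12 (12.6)–(12.8); §18 (18.1)] -/
theorem formDetGlued_nonneg_of_gluedSides {u u' v v' : ℝ → ℂ} (hb : SignAdmissible b)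
    (hK2 : ∀ p₁ q₁ p₂ q₂ : ℂ, ∃ E E' E'' : ℝ → ℂ,
      ContinuousOn E (Icc 0 1) ∧ ContinuousOn E' (Icc 0 1) ∧ ContinuousOn E'' (Icc 0 1) ∧
      (∀ y ∈ Ioo (0:ℝ) 1, HasDerivWithinAt E (E' y) (Ioi y) y) ∧
      (∀ y ∈ Ioo (0:ℝ) 1, HasDerivWithinAt E' (E'' y) (Ioi y) y) ∧
      E 0 = -conj p₂ ∧ E' 0 = conj q₂ ∧ E 1 = p₁ ∧ E' 1 = q₁ ∧
      (∑ j : Fin 3, shiftW b j).re * bulkFormOn b 0 1 E E' E''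
        = freeEndForm b p₁ q₁ + freeEndForm b p₂ q₂
          + π * (F0DetC (shiftGlueW b) (shiftGlue0 b) b (-q₁) p₁ (-q₂) p₂).re)
    (h : GluedSides u u' v v') (N : Finset ℝ) (hN : ∀ x ∈ Ioo (0:ℝ) 1, x ∉ N → HasDerivAt v (v' x) x) :
    0 ≤ FormDetGlued b u u' v v' := by
  obtain ⟨t₁, t₂, ht₁, ht₂, ht, hu, hv⟩ := h.sep
  exact formDetGlued_nonneg_of_twoPointPieces hb hK2 h.kinked₁ h.kinked₂ ht₁ ht₂ ht
    (fun y hy => hu y hy.1) (fun y hy => hv y hy.1) N hN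

end Compose

end Det

end Literature.NumberTheory.LFunctions.Zhang2022
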